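import Summits.CriticalPhenomena.PercolationContinuityZ3.Theorems.PercNearOneGluingNoHeavyLowerTailSahiThreeCopyOrEvents
import Summits.CriticalPhenomena.PercolationContinuityZ3.Theorems.PercNearOneGluingNoHeavyLowerTailSahiThreeCopyCorollaries

/-!
# `NoHeavyLowerTail` (crux stmt-CriticalPhenomena-4575), Sahi programme: **THE CUBE FLIP, THE THREE-CYLINDER SANDWICH FOR UP-CYLINDERS,
# ITS LAW-LEVEL SHADOW `E₃ ≤ ΣCov`, AND 3C-SAHI FOR NOISY-OR FUNCTIONS**

Support file (Sahi cell, seat `prim-sahi-p1`, generation 54; `--supports stmt-CriticalPhenomena-4575`); companion of `…SahiThreeCopyOrEvents`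
(3C-SAHI for OR-events / down-cylinder sandwich).  Pure proofs plus bookkeeping definitions (`flipPt`, `flipEquiv`, `ucyl`, `noisyOr`, `orWeight`);
no `sorry`, standard axioms.

1. **FLIP** (`N3_flip`, `tc_flip`): `N_b(f∘x̄; g∘x̄; h∘x̄) = N_{3−b}(f;g;h)` and `c_b(f∘x̄,g∘x̄,h∘x̄) = c_{3−b}(f,g,h)` for `b ≤ 3` (`x̄ = 1 − x`
   coordinatewise); profiles with an entry `> 3` are empty (`N3_eq_zero_of_three_lt`).  This is step (5) of the formalisation plan of memo
   FROM-prim-sahi-p1-gen53 §9.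
2. **UP-CYLINDER SANDWICH** (`tc_ucyl_le_sum_harris`, every profile): for `u_S = Π_{i∈S} x_i` (indicator of the principal up-set `↑S`),
   `c_b(u_S,u_T,u_U) ≤ H_b(u_S,u_T) + H_b(u_S,u_U) + H_b(u_T,u_U)`, `H_b(u,v) = N_b(uv;1;1) − N_b(u;v;1)` — memo §9 form (ii).  Together with
   `tc_cprod_nonneg` (…Cylinder) the coefficients of three cylinder events are now sandwiched on both sides: `0 ≤ c_b ≤ ΣH_b`.
3. **LAW LEVEL** (`sum_bern3_harris`: `Σ_b m_b(q)·H_b(f,g) = E₂^{coin q}(f,g)`; `sahiE_three_coin_le_sum_cov_of_tc_le`; `sahiE_three_coin_ucyl_le_sum_cov`,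
   `…_dcyl_…`): under every product measure, `E₃(1_{↑S},1_{↑T},1_{↑U}) ≤ Cov(1_{↑S},1_{↑T}) + Cov(1_{↑S},1_{↑U}) + Cov(1_{↑T},1_{↑U})`, i.e. with
   `p_X = Π_{i∈X} q_i`: `2p_{S∪T∪U} − Σ_cyc p_S p_{T∪U} + p_S p_T p_U ≤ Σ_pairs (p_{S∪T} − p_S p_T)`.
4. **NOISY-OR** (`noisyOr`, `noisyOr_eq_sum`, `tc_noisyOr_nonneg`, `sahiE_three_coin_noisyOr_nonneg`): the functions `f_λ(x) = 1 − Π_i(1 − λ_i x_i)`,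
   `λ ∈ [0,1]^d`, are the product-measure mixtures `Σ_S w_S(λ)·1_{A_S}` of OR-events (`Π_i[(1−λ_i) + λ_i(1−x_i)]` expanded), so by trilinearity
   3C-SAHI holds coefficientwise for every triple of noisy-OR functions, and `E₃^{coin q}(f_λ,f_μ,f_ν) ≥ 0` for every coin weight.  (Their
   level sets are weighted-threshold up-sets, which are NOT covered — trilinearity runs from events to functions, not back.)
[this work; conjecture and objects: CENSUS §175 W197 (prim-sahi-census gen 54); memo FROM-prim-sahi-p1-gen53 §9]
-/

namespace Summit.CriticalPhenomena.PercolationContinuityZ3.Theorems.SahiThreeCopy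

open Finset Function Literature.Combinatorics.Sahi2008
open scoped BigOperators

noncomputable section

variable {d : ℕ}

/-! ### §1 The cube flip `x ↦ x̄` and the reflected profile `3 − b` -/

/-- Coordinatewise negation of the cube (the order-reversing involution `x ↦ x̄ = 1 − x`). [this work] -/
def flipPt (x : Pt d) : Pt d := fun i => !x i

/-- `flipPt` is an involution. [this work] -/
@[simp] theorem flipPt_flipPt (x : Pt d) : flipPt (flipPt x) = x := by
  funext i; simp [flipPt]

/-- `flipPt` as an equivalence. [this work] -/
def flipEquiv : Pt d ≃ Pt d := ⟨flipPt, flipPt, flipPt_flipPt, flipPt_flipPt⟩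

/-- Flipping all three copies reflects the profile: `(x̄,ȳ,z̄)` is an arrangement of `b ≤ 3` iff `(x,y,z)` is one of `3 − b`. [this work] -/
theorem isArr_flip_iff {b : Fin d → ℕ} (hb : ∀ i, b i ≤ 3) (x y z : Pt d) :
    IsArr b (flipPt x) (flipPt y) (flipPt z) ↔ IsArr (fun i => 3 - b i) x y z := by
  unfold IsArr flipPt
  refine forall_congr' fun i => ?_
  have := hb i
  cases x i <;> cases y i <;> cases z i <;> simp <;> omega

/-- **Flip invariance of `N_b`**: `N_b(f∘flip; g∘flip; h∘flip) = N_{3−b}(f;g;h)` for `b ≤ 3`. [this work] -/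
theorem N3_flip {b : Fin d → ℕ} (hb : ∀ i, b i ≤ 3) (f g h : Pt d → ℝ) :
    N3 b (f ∘ flipPt) (g ∘ flipPt) (h ∘ flipPt) = N3 (fun i => 3 - b i) f g h := by
  unfold N3
  calc (∑ x, ∑ y, ∑ z, if IsArr b x y z then (f ∘ flipPt) x * (g ∘ flipPt) y * (h ∘ flipPt) z else 0)
      = ∑ x, ∑ y, ∑ z, if IsArr b (flipPt x) (flipPt y) (flipPt z) then f x * g y * h z else 0 := by
        refine Fintype.sum_equiv flipEquiv _ _ fun x => ?_
        refine Fintype.sum_equiv flipEquiv _ _ fun y => ?_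
        refine Fintype.sum_equiv flipEquiv _ _ fun z => ?_
        simp [flipEquiv]
    _ = ∑ x, ∑ y, ∑ z, if IsArr (fun i => 3 - b i) x y z then f x * g y * h z else 0 := by
        simp only [isArr_flip_iff hb]

/-- **Flip invariance of `c_b`**: `c_b(f∘flip, g∘flip, h∘flip) = c_{3−b}(f,g,h)` for `b ≤ 3` — 3C-SAHI for up-sets at `b` is 3C-SAHI for the
flipped (down-)sets read as up-sets of the reversed cube at `3 − b`. [this work] -/
theorem tc_flip {b : Fin d → ℕ} (hb : ∀ i, b i ≤ 3) (f g h : Pt d → ℝ) :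
    tc b (f ∘ flipPt) (g ∘ flipPt) (h ∘ flipPt) = tc (fun i => 3 - b i) f g h :=
  calc tc b (f ∘ flipPt) (g ∘ flipPt) (h ∘ flipPt)
      = 2 * N3 b ((f * g * h) ∘ flipPt) ((1 : Pt d → ℝ) ∘ flipPt) ((1 : Pt d → ℝ) ∘ flipPt) -
          (N3 b (f ∘ flipPt) ((g * h) ∘ flipPt) ((1 : Pt d → ℝ) ∘ flipPt) +
            N3 b (g ∘ flipPt) ((f * h) ∘ flipPt) ((1 : Pt d → ℝ) ∘ flipPt) +
            N3 b (h ∘ flipPt) ((f * g) ∘ flipPt) ((1 : Pt d → ℝ) ∘ flipPt)) +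
          N3 b (f ∘ flipPt) (g ∘ flipPt) (h ∘ flipPt) := rfl
    _ = tc (fun i => 3 - b i) f g h := by
        rw [N3_flip hb, N3_flip hb, N3_flip hb, N3_flip hb, N3_flip hb]; rfl

/-- Profiles with an entry `> 3` have no arrangements: `N_b = 0`. [this work] -/
theorem N3_eq_zero_of_three_lt {b : Fin d → ℕ} {i : Fin d} (hi : 3 < b i) (f g h : Pt d → ℝ) : N3 b f g h = 0 := by
  unfold N3
  refine sum_eq_zero fun x _ => sum_eq_zero fun y _ => sum_eq_zero fun z _ => ?_
  rw [if_neg]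
  intro harr
  have h1 := harr i
  have := Bool.toNat_le (x i); have := Bool.toNat_le (y i); have := Bool.toNat_le (z i)
  omega

/-- Hence `c_b = 0` at such profiles. [this work] -/
theorem tc_eq_zero_of_three_lt {b : Fin d → ℕ} {i : Fin d} (hi : 3 < b i) (f g h : Pt d → ℝ) : tc b f g h = 0 := by
  unfold tc; simp [N3_eq_zero_of_three_lt hi]

/-! ### §2 Up-cylinders and the sandwich at every profile -/

/-- The UP-CYLINDER `u_S(x) = Π_{i ∈ S} x_i`, the indicator of the principal up-set `{x : x_i = 1 ∀ i ∈ S}`, as a coordinate product.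
[this work] -/
def ucyl (S : Finset (Fin d)) : Pt d → ℝ := cprod (fun i => if i ∈ S then 0 else 1) (fun i => if i ∈ S then 1 else 0)

/-- `u_S` is the indicator of `{x : x_i = 1 ∀ i ∈ S}`. [this work] -/
theorem ucyl_apply (S : Finset (Fin d)) (x : Pt d) : ucyl S x = if ∀ i ∈ S, x i = true then 1 else 0 := by
  unfold ucyl cprod
  by_cases h : ∀ i ∈ S, x i = true
  · rw [if_pos h]
    refine prod_eq_one fun i _ => ?_
    by_cases hi : i ∈ S
    · simp [hi, h i hi]
    · simp [hi]
  · rw [if_neg h]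
    push Not at h
    obtain ⟨i, hi, hx⟩ := h
    refine prod_eq_zero (mem_univ i) ?_
    have hx' : x i = false := by cases hxi : x i <;> simp_all
    simp [hi, hx']

/-- `u_S ≥ 0`. [this work] -/
theorem ucyl_nonneg (S : Finset (Fin d)) (x : Pt d) : 0 ≤ ucyl S x :=
  cprod_nonneg (fun i => by split_ifs <;> norm_num) (fun i => by split_ifs <;> norm_num) x

/-- `u_S` is monotone. [this work] -/
theorem ucyl_monotone (S : Finset (Fin d)) : Monotone (ucyl S) :=
  cprod_monotone (fun i => by split_ifs <;> norm_num) (fun i => by split_ifs <;> norm_num)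

/-- `ū_S = u_S ∘ flip`. [this work] -/
theorem dcyl_eq_ucyl_comp_flip (S : Finset (Fin d)) : dcyl S = ucyl S ∘ flipPt := by
  funext x
  simp only [Function.comp, dcyl_apply, ucyl_apply, flipPt, Bool.not_eq_true']

/-- ★★ **The three-cylinder sandwich for UP-cylinders, every profile**: for all `S, T, U ⊆ [d]` and every `b`,
`c_b(u_S, u_T, u_U) ≤ [N_b(u_Su_T;1;1) − N_b(u_S;u_T;1)] + [N_b(u_Su_U;1;1) − N_b(u_S;u_U;1)] + [N_b(u_Tu_U;1;1) − N_b(u_T;u_U;1)]`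
(memo FROM-prim-sahi-p1-gen53 §9 form (ii); from the down-cylinder version at the reflected profile by the cube flip; profiles with an entry `> 3` are
empty). [this work] -/
theorem tc_ucyl_le_sum_harris (b : Fin d → ℕ) (S T U : Finset (Fin d)) :
    tc b (ucyl S) (ucyl T) (ucyl U) ≤
      (N3 b (ucyl S * ucyl T) 1 1 - N3 b (ucyl S) (ucyl T) 1) + (N3 b (ucyl S * ucyl U) 1 1 - N3 b (ucyl S) (ucyl U) 1) +
        (N3 b (ucyl T * ucyl U) 1 1 - N3 b (ucyl T) (ucyl U) 1) := by
  by_cases hb : ∀ i, b i ≤ 3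
  · set b' : Fin d → ℕ := fun i => 3 - b i with hb'def
    have hb' : ∀ i, b' i ≤ 3 := fun i => Nat.sub_le 3 (b i)
    have hbb : (fun i => 3 - b' i) = b := by funext i; have := hb i; simp only [hb'def]; omega
    have e : ∀ F G H : Pt d → ℝ, N3 b' (F ∘ flipPt) (G ∘ flipPt) (H ∘ flipPt) = N3 b F G H := by
      intro F G H; rw [N3_flip hb', hbb]
    have et : ∀ F G H : Pt d → ℝ, tc b' (F ∘ flipPt) (G ∘ flipPt) (H ∘ flipPt) = tc b F G H := by
      intro F G H; rw [tc_flip hb', hbb]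
    have key : tc b' (ucyl S ∘ flipPt) (ucyl T ∘ flipPt) (ucyl U ∘ flipPt) ≤
        (N3 b' ((ucyl S * ucyl T) ∘ flipPt) ((1 : Pt d → ℝ) ∘ flipPt) ((1 : Pt d → ℝ) ∘ flipPt) -
            N3 b' (ucyl S ∘ flipPt) (ucyl T ∘ flipPt) ((1 : Pt d → ℝ) ∘ flipPt)) +
          (N3 b' ((ucyl S * ucyl U) ∘ flipPt) ((1 : Pt d → ℝ) ∘ flipPt) ((1 : Pt d → ℝ) ∘ flipPt) -
            N3 b' (ucyl S ∘ flipPt) (ucyl U ∘ flipPt) ((1 : Pt d → ℝ) ∘ flipPt)) +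
          (N3 b' ((ucyl T * ucyl U) ∘ flipPt) ((1 : Pt d → ℝ) ∘ flipPt) ((1 : Pt d → ℝ) ∘ flipPt) -
            N3 b' (ucyl T ∘ flipPt) (ucyl U ∘ flipPt) ((1 : Pt d → ℝ) ∘ flipPt)) := by
      have h := tc_dcyl_le_sum_harris b' S T U
      simp only [dcyl_eq_ucyl_comp_flip] at h
      exact h
    rw [et, e, e, e, e, e, e] at key
    exact key
  · push Not at hb
    obtain ⟨i, hi⟩ := hb
    simp [tc_eq_zero_of_three_lt hi, N3_eq_zero_of_three_lt hi]

/-- 3C-SAHI for OR-events, flipped form: `0 ≤ c_b(1 − u_S, 1 − u_T, 1 − u_U)` is NOT claimed (those are down-sets); what the flip gives is the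
up-cylinder sandwich above.  For the record, the complement identity turns it into: `c_b(1−u_S,1−u_T,1−u_U) ≥ 0` at every `b`. [this work] -/
theorem tc_one_sub_ucyl_nonneg (b : Fin d → ℕ) (S T U : Finset (Fin d)) :
    0 ≤ tc b (1 - ucyl S) (1 - ucyl T) (1 - ucyl U) := by
  rw [tc_compl]
  have := tc_ucyl_le_sum_harris b S T U
  linarith

/-! ### §3 Law level: `E₃ ≤ Cov + Cov + Cov` for three cylinder events under every product measure -/

/-- The Bernstein sum of the three-copy Harris gaps is the covariance: `Σ_b m_b(q)·[N_b(fg;1;1) − N_b(f;g;1)] = E₂^{coin q}(f,g)`. [this work] -/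
theorem sum_bern3_harris (q : Fin d → ℝ) (f g : Pt d → ℝ) :
    ∑ b : Fin d → Fin 4, bern3 q (fun i => ((b i : Fin 4) : ℕ)) *
        (N3 (fun i => ((b i : Fin 4) : ℕ)) (f * g) 1 1 - N3 (fun i => ((b i : Fin 4) : ℕ)) f g 1) =
      sahiE (coinWeight q) 2 ![f, g] := by
  have h3 := sahiE_three_coinWeight q f g 1
  simp only [tc_one_right] at h3
  rw [← h3, sahiE_three, sahiE_two, mul_one, mul_one, ex_one (sum_coinWeight q)]
  ring

/-- Summing a coefficientwise sandwich against the Bernstein weights: if `c_b(f,g,h) ≤ H_b(f,g) + H_b(f,h) + H_b(g,h)` for every `b`, then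
`E₃^{coin q}(f,g,h) ≤ E₂^{coin q}(f,g) + E₂^{coin q}(f,h) + E₂^{coin q}(g,h)` for every `q ∈ [0,1]^d`. [this work] -/
theorem sahiE_three_coin_le_sum_cov_of_tc_le {q : Fin d → ℝ} (hq : ∀ i, 0 ≤ q i ∧ q i ≤ 1) {f g h : Pt d → ℝ}
    (H : ∀ b : Fin d → ℕ, tc b f g h ≤ (N3 b (f * g) 1 1 - N3 b f g 1) + (N3 b (f * h) 1 1 - N3 b f h 1) +
      (N3 b (g * h) 1 1 - N3 b g h 1)) :
    sahiE (coinWeight q) 3 ![f, g, h] ≤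
      sahiE (coinWeight q) 2 ![f, g] + sahiE (coinWeight q) 2 ![f, h] + sahiE (coinWeight q) 2 ![g, h] := by
  rw [sahiE_three_coinWeight, ← sum_bern3_harris q f g, ← sum_bern3_harris q f h, ← sum_bern3_harris q g h,
    ← sum_add_distrib, ← sum_add_distrib]
  refine sum_le_sum fun b _ => ?_
  have hb := bern3_nonneg hq (fun i => ((b i : Fin 4) : ℕ))
  have := H (fun i => ((b i : Fin 4) : ℕ))
  nlinarith

/-- ★ **Law level, three cylinder events**: for every coin weight `q ∈ [0,1]^d` and all `S, T, U ⊆ [d]`,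
`E₃^{coin q}(1_{↑S}, 1_{↑T}, 1_{↑U}) ≤ Cov(1_{↑S},1_{↑T}) + Cov(1_{↑S},1_{↑U}) + Cov(1_{↑T},1_{↑U})` — with `p_X = Π_{i∈X} q_i`:
`2p_{S∪T∪U} − p_S p_{T∪U} − p_T p_{S∪U} − p_U p_{S∪T} + p_S p_T p_U ≤ Σ_{pairs} (p_{S∪T} − p_S p_T)`.  (The lower bound `0 ≤ E₃` here is
Sahi's Theorem 2 / the tree's `sahiE3_cylinder_nonneg`; the upper bound is the law-level shadow of the coefficientwise sandwich.) [this work] -/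
theorem sahiE_three_coin_ucyl_le_sum_cov {q : Fin d → ℝ} (hq : ∀ i, 0 ≤ q i ∧ q i ≤ 1) (S T U : Finset (Fin d)) :
    sahiE (coinWeight q) 3 ![ucyl S, ucyl T, ucyl U] ≤
      sahiE (coinWeight q) 2 ![ucyl S, ucyl T] + sahiE (coinWeight q) 2 ![ucyl S, ucyl U] +
        sahiE (coinWeight q) 2 ![ucyl T, ucyl U] :=
  sahiE_three_coin_le_sum_cov_of_tc_le hq fun b => tc_ucyl_le_sum_harris b S T U

/-- The same for three DOWN-cylinder (decreasing) events `{x_S = 0}, {x_T = 0}, {x_U = 0}`. [this work] -/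
theorem sahiE_three_coin_dcyl_le_sum_cov {q : Fin d → ℝ} (hq : ∀ i, 0 ≤ q i ∧ q i ≤ 1) (S T U : Finset (Fin d)) :
    sahiE (coinWeight q) 3 ![dcyl S, dcyl T, dcyl U] ≤
      sahiE (coinWeight q) 2 ![dcyl S, dcyl T] + sahiE (coinWeight q) 2 ![dcyl S, dcyl U] +
        sahiE (coinWeight q) 2 ![dcyl T, dcyl U] :=
  sahiE_three_coin_le_sum_cov_of_tc_le hq fun b => tc_dcyl_le_sum_harris b S T U

/-! ### §4 Noisy-OR functions: the product-measure mixtures of OR-events -/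

/-- The NOISY-OR function `f_λ(x) = 1 − Π_i (1 − λ_i x_i)` (probability that at least one present cause `i` (`x_i = 1`) fires, cause `i` firing
independently with probability `λ_i`); `λ = 1_S` gives the OR-event `1_{A_S}`. [this work] -/
def noisyOr (lam : Fin d → ℝ) : Pt d → ℝ := fun x => 1 - ∏ i, (if x i then 1 - lam i else 1)

/-- The mixture weights `w_S(λ) = Π_{i∈S} λ_i · Π_{i∉S} (1 − λ_i)`. [this work] -/
def orWeight (lam : Fin d → ℝ) (S : Finset (Fin d)) : ℝ := (∏ i ∈ S, lam i) * ∏ i ∈ Sᶜ, (1 - lam i)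

/-- `w_S(λ) ≥ 0` for `λ ∈ [0,1]^d`. [this work] -/
theorem orWeight_nonneg {lam : Fin d → ℝ} (hl : ∀ i, 0 ≤ lam i ∧ lam i ≤ 1) (S : Finset (Fin d)) : 0 ≤ orWeight lam S :=
  mul_nonneg (prod_nonneg fun i _ => (hl i).1) (prod_nonneg fun i _ => sub_nonneg.2 (hl i).2)

/-- `Σ_S w_S(λ) = 1`. [this work] -/
theorem sum_orWeight (lam : Fin d → ℝ) : ∑ S : Finset (Fin d), orWeight lam S = 1 := by
  have h := (prod_add (fun i => lam i) (fun i => 1 - lam i) (univ : Finset (Fin d))).symm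
  simp only [add_sub_cancel, prod_const_one] at h
  rw [← h, ← powerset_univ]
  refine sum_congr rfl fun S _ => ?_
  rw [orWeight, compl_eq_univ_sdiff]

/-- **Noisy-OR = mixture of OR-events**: `f_λ = Σ_S w_S(λ)·1_{A_S}` (expand `Π_i[(1−λ_i) + λ_i(1 − x_i)]`). [this work] -/
theorem noisyOr_eq_sum (lam : Fin d → ℝ) : noisyOr lam = ∑ S : Finset (Fin d), orWeight lam S • orInd S := by
  funext x
  have hx : ∏ i, (if x i then 1 - lam i else 1) = ∑ S : Finset (Fin d), orWeight lam S * dcyl S x := by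
    have h := prod_add (fun i => lam i * if x i = false then 1 else 0) (fun i => 1 - lam i) (univ : Finset (Fin d))
    have e : ∀ i, (lam i * (if x i = false then 1 else 0) + (1 - lam i)) = (if x i then 1 - lam i else 1) := by
      intro i; cases x i <;> simp
    simp only [e] at h
    rw [h, ← powerset_univ]
    refine sum_congr rfl fun S _ => ?_
    rw [orWeight, compl_eq_univ_sdiff, prod_mul_distrib, dcyl_apply, prod_boole]
    ring
  simp only [noisyOr, Finset.sum_apply, Pi.smul_apply, smul_eq_mul, orInd_eq_one_sub_dcyl, Pi.sub_apply, Pi.one_apply, mul_sub,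
    mul_one, sum_sub_distrib, sum_orWeight, hx]

/-- ★ **3C-SAHI for every triple of noisy-OR functions** (coefficientwise): for `λ, μ, ν ∈ [0,1]^d` and every profile `b`,
`0 ≤ c_b(f_λ, f_μ, f_ν)` — trilinearity over the OR-event theorem `tc_orInd_nonneg`. [this work] -/
theorem tc_noisyOr_nonneg (b : Fin d → ℕ) {lam mu nu : Fin d → ℝ} (hl : ∀ i, 0 ≤ lam i ∧ lam i ≤ 1) (hm : ∀ i, 0 ≤ mu i ∧ mu i ≤ 1)
    (hn : ∀ i, 0 ≤ nu i ∧ nu i ≤ 1) : 0 ≤ tc b (noisyOr lam) (noisyOr mu) (noisyOr nu) := by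
  rw [noisyOr_eq_sum lam, tc_finset_sum_smul_left]
  refine sum_nonneg fun S _ => mul_nonneg (orWeight_nonneg hl S) ?_
  rw [tc_comm12, noisyOr_eq_sum mu, tc_finset_sum_smul_left]
  refine sum_nonneg fun T _ => mul_nonneg (orWeight_nonneg hm T) ?_
  rw [tc_comm23, tc_comm12, noisyOr_eq_sum nu, tc_finset_sum_smul_left]
  refine sum_nonneg fun U _ => mul_nonneg (orWeight_nonneg hn U) ?_
  exact tc_orInd_nonneg b U T S

/-- Law level: `0 ≤ E₃^{coin q}(f_λ, f_μ, f_ν)` for all noisy-OR triples and every coin weight `q ∈ [0,1]^d`. [this work] -/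
theorem sahiE_three_coin_noisyOr_nonneg {q : Fin d → ℝ} (hq : ∀ i, 0 ≤ q i ∧ q i ≤ 1) {lam mu nu : Fin d → ℝ}
    (hl : ∀ i, 0 ≤ lam i ∧ lam i ≤ 1) (hm : ∀ i, 0 ≤ mu i ∧ mu i ≤ 1) (hn : ∀ i, 0 ≤ nu i ∧ nu i ≤ 1) :
    0 ≤ sahiE (coinWeight q) 3 ![noisyOr lam, noisyOr mu, noisyOr nu] :=
  sahiE_three_coin_nonneg_of_tc hq fun b => tc_noisyOr_nonneg b hl hm hn

end

end Summit.CriticalPhenomena.PercolationContinuityZ3.Theorems.SahiThreeCopy
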